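/-
Copyright (c) 2026 the pub-hodgecm-mathlib formalisation cell (harness21).  Prover seat hodgecm-mathlib-A-p16 (g33): road «S3-ram» (LEAD F0P3a-plan (g13); owner lineage
F0P3a-p06), (Cnt2′) ROUTE B (chair F0P3a-p07 (g15) RULINGS (17)∕(18)): «ANISO ROOT CENSUS IN PARAMS CURRENCY» (F0P3-p01 (g19) 05:13:27Z ask (ii)), CM dress at the J0diff
aniso binders + the centring `(s hs γ′ hγ′)`; FILE Z8; 2026-09-02.
-/
import Literature.NumberTheory.Rogawski1990.DepthZeroKappaTransferTypeTwoRamifiedAnisotropicTotalsOdd      -- ★ p849189 (this seat): `valued_det_sub_smul_one_eq_of_tokens`, `valued_sq_sub_eq_one_of_not_exists_norm`, `v_smul_sub_one_apply_eq_of_mul_eq_one`; brings the CM dictionary, ★ centring, ★ conformality, ★ non-contraction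
import Literature.NumberTheory.Rogawski1990.DepthZeroKappaTransferTypeTwoRamifiedAnisotropicRootSlices     -- ★ p849483 (F0P2-p01 (g17)): `rootSlices_anisotropic_of_lineCounts`
import Literature.NumberTheory.Rogawski1990.DepthZeroKappaTransferTypeTwoRamifiedRootValueLines            -- ★ p849383 (F0P3a-p01 (g18)): `ncard_rootChildren_{null,negClass,negClass_mul}_eq_natCard`, `quadraticChar_residue_eq_neg_one_of_forall`
import Literature.NumberTheory.Rogawski1990.DepthZeroKappaTransferTypeTwoRamifiedAnisotropicRootResidual   -- ★ p849644 (F0P2-p01 (g17)): `exists_residualFrame_of_coe_eq_conj_endoGL_of_tie`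
import Literature.NumberTheory.Rogawski1990.DepthZeroKappaTransferTypeTwoRamifiedDepthSign                -- ★ p849319 (chair F0P3a-p07 (g15)): `typeTwo_hilbertSymbol_eq_one_iff_exists_sq_ram`
import Literature.NumberTheory.Automorphic.UnitaryLatticeTreeNilpotencyTokenOfDepths                        -- ★ `map_sub_one_pow_three_le_scaleLattice_of_charpoly_block_antidiagonal`
import Literature.NumberTheory.Automorphic.UnitaryLatticeTreeFramesOfInvolution                             -- ★ `isTree_latticeGraph_three_of_neg`
import Literature.NumberTheory.Automorphic.UnitaryLatticeTreeResidualTokens                                 -- ★ `exists_unit_v_sub_mul_sq_lt_one_iff_residue`; brings ★ `exists_ne_zero_eq_mul_sq_iff_quadraticChar`, `residue_eq_zero_iff_v_lt_one`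
import HarnessLib

/-!
# «ANISO ROOT CENSUS IN PARAMS CURRENCY» — the anisotropic literal's residual frame, sign clause and three root slices at the tie, as residual-conic fibres
# (Rogawski 1990 §4.9; Kottwitz 1986 §3; Labesse–Langlands 1979 §2; Bruhat–Tits 1972 §10)

Topic `NumberTheory/Rogawski1990`; namespace `Literature.NumberTheory.Rogawski1990.BlockLawAniso`.  THEOREMS ONLY (no definition, no instance, no notation, no named fact,
no `sorry`); kernel lane `--supports stmt-HodgeConjecture-24833`; cell `pub/hodgecm-mathlib` (D-0151), crux H413; road «S3-ram» (count-neutral).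

`anisotropicRootCensus_params_odd_ram` — the ANISOTROPIC TWIN of ★ `BlockLawHyp.hyperbolicRootCensus_params_odd_ram` (F0P3a-p01 (g18), p849618), for F0P3-p01 (g19)'s joint cell
`stub_Zpair_pm_odd_A` (ask (ii), 05:13:27Z) and this seat's `stub_Zaniso_zero_odd_A`: at the (Cnt2′) J0diff binders of the anisotropic literal `Y = P₁·ι(γ₁, u_w)·P₁⁻¹`
(`hblk hu2 hm hβ`; regimes A-odd ∕ C: `m = 2n + 1`, `n ≥ 1`; the frame `P₁ ∈ GL₃(𝒪_w)` with `ᵗσ(P₁)·Φ₃·P₁ = ι(diag d, η)`, `diag d̄` anisotropic, `η` a `σ_w`-fixed unit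
non-norm, `γ₁ ∈ U(σ_w, diag d)` two-deep with the spectral tie `χ_{γ₁} = χ_{g_w}`, `|disc γ₁| = |ϖ|^{2N}`, rootless), the centring unit `s` (`s·u_w = 1`), the centred
literal `γ′ = P₁·ι(s·γ₁, 1)·P₁⁻¹ ∈ U(σ_w, J₃)` and a unit class constant `c = c₀`, there are a residual frame `Ā ∈ GL₃(𝓀_w)`, `δ = (d̄₀, η̄, d̄₁)`, the integral leading
matrices `Y₀ = (ϖ^m)⁻¹(γ′ − 1) ∈ M₃(𝒪_w)`, `T = (ϖ^m)⁻¹(s·γ₁ − 1) ∈ M₂(𝒪_w)` and `B = Ā⁻¹·Ȳ₀·Ā ∈ M₃(𝓀_w)` with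
* `ᵗĀ·J̄₀·Ā = diag δ`, all `δᵢ ≠ 0`, `χ(−δ₀δ₂) = −1` (anisotropic root plane), `χ(δ₁) = χ(η̄) = −1` (non-norm), hence the class key `χ(δ₁δ₀δ₂) = χ(−1)`;
* `B = ι(T̄, 0)` entrywise at `(i₀; j, l) = (1; 0, 2)` (`B₁₀ = B₁₂ = B₀₁ = B₂₁ = B₁₁ = 0`), `δ₀B₀₂ = δ₂B₂₀` (odd-depth symmetry), `χ((B₀₀ − B₂₂)² + 4B₀₂B₂₀) = −1`
  (residual irreducibility at the tie) — the `(A, Y, B, δ) hG hY hB₁–hB₄ hadj hirr` inputs of ★ `TypeTwoBlockRoot.natCard_params_blockFrame_null_eq'` ∕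
  `two_mul_natCard_params_blockFrame_quadraticChar_eq'` (F0P3a-p02 (g18), p849444) — all of this is ★ p849644 (F0P2-p01 (g17)) at the centred pair;
* `det T̄ ≠ 0` and **`(β, θ)_v = 1 ⟺ χ(det T̄) = 1`** (★ chair p849319 ∘ `det(s·γ₁ − 1) = s²·(χ_g(u))_w`);
* the three root slices of ★ p849189 ∕ ★ p849291's `hNE hNP hNM` binders AT `γ′` (the `#E`, `#P(c)`, `#M(c)` grandchild sets) equal `q·#{p : Q_{Ȳ₀}(x_p) = 0}`,
  `q·#{p : χ((−c̄₀)⁻¹Q_{Ȳ₀}(x_p)) = 1}`, `q·#{p : χ((−c̄₀)⁻¹Q_{Ȳ₀}(x_p)) = −1}` on ★ G3⁗'s `q + 1` conic points (★ p849483 §2 ∘ ★ p849383).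
Proof = the CM dress of ★ p849189's cell (dictionary, centring, conformality ⇒ `|s·γ₁ − 1| ≤ |ϖ|^m`, non-contraction, nil-cube via the centred characteristic polynomial,
root level) + ★ p849483 §2 with `ν := Nat.card` through ★ p849383 + ★ p849644 + the sign bridge of ★ p849618's proof (`exists_unit_v_sub_mul_sq_lt_one_iff_residue`).
HONEST LABEL: HC_CM is proved only modulo the 2 remaining named inputs (hLiu418 24832, h413 24833) until rung 0 closes; composition of ★ theorems; «S3-ram» has no books consequence.

## References
* [Rogawski1990] J. D. Rogawski, *Automorphic Representations of Unitary Groups in Three Variables*, Ann. of Math. Stud. 123 (1990), §4.9 Prop. 4.9.1 (b) p. 55, Lemma 4.9.3 p. 56.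
* [Kottwitz1986] R. E. Kottwitz, *Base change for unit elements of Hecke algebras*, Compositio Math. 60 (1986), §3.
* [LabesseLanglands1979] J.-P. Labesse, R. P. Langlands, *L-indistinguishability for SL(2)*, Canad. J. Math. 31 (1979), §2 Lemma 2.1.
* [BruhatTits1972] F. Bruhat, J. Tits, *Groupes réductifs sur un corps local I*, Publ. Math. IHÉS 41 (1972), §10.
-/

set_option autoImplicit false

noncomputable section

open NumberField IsDedekindDomain Matrix Polynomial ValuativeRel
open Literature.NumberTheory.Automorphic Literature.NumberTheory.Automorphic.UnitaryGroup
open Literature.NumberTheory.Automorphic.UnitaryLatticeTree Literature.NumberTheory.Automorphic.HermitianLattice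
open Literature.NumberTheory.GaloisRepresentations Literature.NumberTheory.QuadraticForms
open Literature.NumberTheory.Rogawski1990 Literature.NumberTheory.Rogawski1990.TypeOneRamifiedJunction
open scoped Matrix MatrixGroups ValuativeRel WithZero

namespace Literature.NumberTheory.Rogawski1990.BlockLawAniso

variable (L : Type) [Field L] [NumberField L] [IsCMField L] {v : HeightOneSpectrum (𝓞 ↥(maximalRealSubfield L))}

set_option maxHeartbeats 3200000 in
-- budget only: statement-heavy socket tokens (★ p849189's `hNE hNP hNM` texts verbatim) and three statement-heavy ★ heads instantiated; the proof is a composition, no search.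
/-- **«ANISO ROOT CENSUS IN PARAMS CURRENCY»** (regimes A-odd ∕ C, `m = 2n+1`; see the module docstring): the residual frame `(Ā, δ, Y₀, T, B)` of the centred anisotropic
literal `γ′ = P₁·ι(s·γ₁, 1)·P₁⁻¹` in ★ p849444's binder currency, the keys `χ(−δ₀δ₂) = χ(δ₁) = −1`, `χ(δ₁δ₀δ₂) = χ(−1)`, the sign clause `(β,θ)_v = 1 ⟺ χ(det T̄) = 1`, and
the three root slices of ★ p849189 ∕ ★ p849291 at `γ′` as `q` times residual-conic fibres. [cite: Rogawski1990, §4.9 Prop. 4.9.1 (b) p. 55, Lemma 4.9.3 p. 56] [cite: Kottwitz1986, §3]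
[cite: LabesseLanglands1979, §2 Lemma 2.1] [cite: BruhatTits1972, §10] -/
theorem anisotropicRootCensus_params_odd_ram (w : PlacesOver L v)
    (hw : IsCMField.complexConj L • w.1 = w.1) (he : v.asIdeal.ramificationIdx' w.1.asIdeal ≠ 1)
    (h2 : IsUnit (2 : 𝒪[(w.1.adicCompletion L)]))
    (ϖ : w.1.adicCompletion L) (hϖ : Valued.v ϖ = WithZero.exp (-1 : ℤ)) (hσϖ : galAdicCompletionMap (L := L) (IsCMField.complexConj L) hw ϖ = -ϖ)
    (γH : ((cmDatum L 2 (Matrix.of fun i j : Fin 2 => if i.val + j.val + 1 = 2 then (1 : L) else 0)).Local v ×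
      (cmDatum L 1 (Matrix.of fun i j : Fin 1 => if i.val + j.val + 1 = 1 then (1 : L) else 0)).Local v))
    (hblk : ∀ i j : Fin 2, Valued.v (((((γH.1.val : GL (Fin 2) (UnitaryGroup.LocalRing L v)).val.map (Pi.evalRingHom (fun w' : PlacesOver L v => w'.1.adicCompletion L) w))) - 1) i j) ≤ Valued.v (ϖ ^ 2))
    (hu2 : Valued.v (finGammaTwo L v γH w - 1) ≤ Valued.v (ϖ ^ 2))
    (m : ℕ) (hm : Valued.v (((finCharpolyTwo L v γH).eval (finGammaTwo L v γH)) w) =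
          Valued.v ((toPlace v w (HeckeCharacter.uniformizer ↥(maximalRealSubfield L) v : v.adicCompletion ↥(maximalRealSubfield L))) ^ m))
    {n : ℕ} (hn : 1 ≤ n)
    (β : (v.adicCompletion ↥(maximalRealSubfield L))ˣ)
    (hβ : toPlace v w (β : v.adicCompletion ↥(maximalRealSubfield L)) =
          -(((finCharpolyTwo L v γH).eval (finGammaTwo L v γH)) w *
              (finGammaTwo L v γH w ^ 2 +
                ((γH.1.val.val : Matrix (Fin 2) (Fin 2) (LocalRing L v)).map (Pi.evalRingHom (fun w' : PlacesOver L v => w'.1.adicCompletion L) w)).det)) /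
            (2 * finGammaTwo L v γH w ^ 2 *
              ((γH.1.val.val : Matrix (Fin 2) (Fin 2) (LocalRing L v)).map (Pi.evalRingHom (fun w' : PlacesOver L v => w'.1.adicCompletion L) w)).det))
    (hmN : m = 2 * n + 1)
    (P₁ : GL (Fin 3) (w.1.adicCompletion L)) (d : Fin 2 → (w.1.adicCompletion L)) (η : (w.1.adicCompletion L)) (γ₁ : GL (Fin 2) (w.1.adicCompletion L))
    (hP₁ : P₁ ∈ glInt 3 (w.1.adicCompletion L))
    (hform : formCongr (galAdicCompletionMap (L := L) (IsCMField.complexConj L) hw) P₁ (placeForm (Matrix.of fun i j : Fin 3 => if i.val + j.val + 1 = 3 then (1 : L) else 0) w.1) = !![(Matrix.diagonal d) 0 0, 0, (Matrix.diagonal d) 0 1; 0, η, 0; (Matrix.diagonal d) 1 0, 0, (Matrix.diagonal d) 1 1])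
    (hd : ∀ i, Valued.v (d i) = 1) (_hσd : ∀ i, (galAdicCompletionMap (L := L) (IsCMField.complexConj L) hw) (d i) = d i)
    (han₀ : ∀ z : (w.1.adicCompletion L), Valued.v z ≤ 1 → Valued.v (d 0 + d 1 * ((galAdicCompletionMap (L := L) (IsCMField.complexConj L) hw) z * z)) = 1)
    (han₁ : ∀ z : (w.1.adicCompletion L), Valued.v z ≤ 1 → Valued.v (d 0 * ((galAdicCompletionMap (L := L) (IsCMField.complexConj L) hw) z * z) + d 1) = 1)
    (hση : (galAdicCompletionMap (L := L) (IsCMField.complexConj L) hw) η = η) (hηv : Valued.v η = 1)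
    (hγ2 : ∀ i j, Valued.v (((γ₁ : Matrix (Fin 2) (Fin 2) (w.1.adicCompletion L)) - 1) i j) ≤ Valued.v (ϖ ^ 2))
    (hγU : γ₁ ∈ unitaryGroupOfForm (galAdicCompletionMap (L := L) (IsCMField.complexConj L) hw) (Matrix.diagonal d))
    (hχ : (γ₁ : Matrix (Fin 2) (Fin 2) (w.1.adicCompletion L)).charpoly = (((γH.1.val : GL (Fin 2) (UnitaryGroup.LocalRing L v)).val.map (Pi.evalRingHom (fun w' : PlacesOver L v => w'.1.adicCompletion L) w))).charpoly)
    (hdiscγ : Valued.v ((γ₁ : Matrix (Fin 2) (Fin 2) (w.1.adicCompletion L)).trace ^ 2 - 4 * (γ₁ : Matrix (Fin 2) (Fin 2) (w.1.adicCompletion L)).det) = WithZero.exp (-((2 * (2 * n + 1) : ℕ) : ℤ)))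
    (hirrγ : ¬ ∃ x : (w.1.adicCompletion L), ((γ₁ : Matrix (Fin 2) (Fin 2) (w.1.adicCompletion L)).charpoly).IsRoot x)
    (hηN : ¬ ∃ t : (w.1.adicCompletion L), t * (galAdicCompletionMap (L := L) (IsCMField.complexConj L) hw) t = η)
    (s : (w.1.adicCompletion L)ˣ) (hs : (s : w.1.adicCompletion L) * finGammaTwo L v γH w = 1)
    (γ' : unitaryGroupOfForm (galAdicCompletionMap (L := L) (IsCMField.complexConj L) hw) ((StdForm.antidiagonal 3).over (w.1.adicCompletion L)))
    (hγ' : (γ' : GL (Fin 3) (w.1.adicCompletion L)) = P₁ * endoGL (Matrix.GeneralLinearGroup.scalar (Fin 2) s * γ₁, (1 : GL (Fin 1) (w.1.adicCompletion L))) * P₁⁻¹)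
    [Fintype (Valued.ResidueField (w.1.adicCompletion L))] [DecidableEq (Valued.ResidueField (w.1.adicCompletion L))]
    (c : w.1.adicCompletion L) (c₀ : Valued.integer (w.1.adicCompletion L)) (hc₀ : (c₀ : w.1.adicCompletion L) = c) (hc : Valued.v c = 1) :
    ∃ (Ab : GL (Fin 3) (Valued.ResidueField (w.1.adicCompletion L))) (δ : Fin 3 → (Valued.ResidueField (w.1.adicCompletion L))) (Y₀ : Matrix (Fin 3) (Fin 3) (Valued.integer (w.1.adicCompletion L))) (T : Matrix (Fin 2) (Fin 2) (Valued.integer (w.1.adicCompletion L))) (B : Matrix (Fin 3) (Fin 3) (Valued.ResidueField (w.1.adicCompletion L))),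
      (∀ i j, ((Y₀ i j : Valued.integer (w.1.adicCompletion L)) : (w.1.adicCompletion L)) = (ϖ ^ m)⁻¹ * ((((γ' : GL (Fin 3) (w.1.adicCompletion L)) : Matrix (Fin 3) (Fin 3) (w.1.adicCompletion L)) - 1) i j)) ∧
      (∀ i j, ((T i j : Valued.integer (w.1.adicCompletion L)) : (w.1.adicCompletion L)) = (ϖ ^ m)⁻¹ * ((((Matrix.GeneralLinearGroup.scalar (Fin 2) s * γ₁ : GL (Fin 2) (w.1.adicCompletion L)) : Matrix (Fin 2) (Fin 2) (w.1.adicCompletion L)) - 1) i j)) ∧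
      ((Ab : Matrix (Fin 3) (Fin 3) (Valued.ResidueField (w.1.adicCompletion L))))ᵀ * ((StdForm.antidiagonal 3).over (Valued.ResidueField (w.1.adicCompletion L))) * (Ab : Matrix (Fin 3) (Fin 3) (Valued.ResidueField (w.1.adicCompletion L))) = Matrix.diagonal δ ∧
      (∀ i, δ i ≠ 0) ∧
      quadraticChar (Valued.ResidueField (w.1.adicCompletion L)) (-(δ 0 * δ 2)) = -1 ∧
      quadraticChar (Valued.ResidueField (w.1.adicCompletion L)) (δ 1) = -1 ∧
      quadraticChar (Valued.ResidueField (w.1.adicCompletion L)) (δ 1 * δ 0 * δ 2) = quadraticChar (Valued.ResidueField (w.1.adicCompletion L)) (-1) ∧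
      ((Ab⁻¹ : GL (Fin 3) (Valued.ResidueField (w.1.adicCompletion L))) : Matrix (Fin 3) (Fin 3) (Valued.ResidueField (w.1.adicCompletion L))) * Y₀.map (IsLocalRing.residue (Valued.integer (w.1.adicCompletion L))) * (Ab : Matrix (Fin 3) (Fin 3) (Valued.ResidueField (w.1.adicCompletion L))) = B ∧
      B 1 0 = 0 ∧ B 1 2 = 0 ∧ B 0 1 = 0 ∧ B 2 1 = 0 ∧ B 1 1 = 0 ∧
      B 0 0 = IsLocalRing.residue (Valued.integer (w.1.adicCompletion L)) (T 0 0) ∧ B 0 2 = IsLocalRing.residue (Valued.integer (w.1.adicCompletion L)) (T 0 1) ∧ B 2 0 = IsLocalRing.residue (Valued.integer (w.1.adicCompletion L)) (T 1 0) ∧ B 2 2 = IsLocalRing.residue (Valued.integer (w.1.adicCompletion L)) (T 1 1) ∧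
      δ 0 * B 0 2 = δ 2 * B 2 0 ∧
      quadraticChar (Valued.ResidueField (w.1.adicCompletion L)) ((B 0 0 - B 2 2) ^ 2 + 4 * (B 0 2 * B 2 0)) = -1 ∧
      IsLocalRing.residue (Valued.integer (w.1.adicCompletion L)) (T 0 0 * T 1 1 - T 0 1 * T 1 0) ≠ 0 ∧
      (hilbertSymbol (v.adicCompletion ↥(maximalRealSubfield L)) (β : v.adicCompletion ↥(maximalRealSubfield L)) (algebraMap ↥(maximalRealSubfield L) _ ((cmQuadraticGenerator L : 𝓞 ↥(maximalRealSubfield L)) : ↥(maximalRealSubfield L))) = 1 ↔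
        quadraticChar (Valued.ResidueField (w.1.adicCompletion L)) (IsLocalRing.residue (Valued.integer (w.1.adicCompletion L)) (T 0 0 * T 1 1 - T 0 1 * T 1 0)) = 1) ∧
      ({x | x ∈ {x | ∃ p, ((latticeGraph (galAdicCompletionMap (L := L) (IsCMField.complexConj L) hw) ϖ ((StdForm.antidiagonal 3).over (w.1.adicCompletion L))).Adj (⟨stdLattice (w.1.adicCompletion L) 3, 0, isSelfDualLattice_stdLattice_three_of_v hϖ⟩ : {M : Submodule (Valued.integer (w.1.adicCompletion L)) (Fin 3 → (w.1.adicCompletion L)) // IsVertex (galAdicCompletionMap (L := L) (IsCMField.complexConj L) hw) ϖ ((StdForm.antidiagonal 3).over (w.1.adicCompletion L)) M}) p ∧ (latticeGraph (galAdicCompletionMap (L := L) (IsCMField.complexConj L) hw) ϖ ((StdForm.antidiagonal 3).over (w.1.adicCompletion L))).dist ⟨stdLattice (w.1.adicCompletion L) 3, 0, isSelfDualLattice_stdLattice_three_of_v hϖ⟩ p = (latticeGraph (galAdicCompletionMap (L := L) (IsCMField.complexConj L) hw) ϖ ((StdForm.antidiagonal 3).over (w.1.adicCompletion L))).dist ⟨stdLattice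 (w.1.adicCompletion L) 3, 0, isSelfDualLattice_stdLattice_three_of_v hϖ⟩ (⟨stdLattice (w.1.adicCompletion L) 3, 0, isSelfDualLattice_stdLattice_three_of_v hϖ⟩ : {M : Submodule (Valued.integer (w.1.adicCompletion L)) (Fin 3 → (w.1.adicCompletion L)) // IsVertex (galAdicCompletionMap (L := L) (IsCMField.complexConj L) hw) ϖ ((StdForm.antidiagonal 3).over (w.1.adicCompletion L)) M}) + 1 ∧ latticeGraphIso (galAdicCompletionMap (L := L) (IsCMField.complexConj L) hw) ϖ ((StdForm.antidiagonal 3).over (w.1.adicCompletion L)) γ' p = p) ∧ ((latticeGraph (galAdicCompletionMap (L := L) (IsCMField.complexConj L) hw) ϖ ((StdForm.antidiagonal 3).over (w.1.adicCompletion L))).Adj p x ∧ (latticeGraph (galAdicCompletionMap (L := L) (IsCMField.complexConj L) hw) ϖ ((StdForm.antidiagonal 3).over (w.1.adicCompletion L))).dist ⟨stdLattice (w.1.adicCompletion L) 3, 0, isSelfDualLattice_stdLattice_three_of_v hϖ⟩ x = (latticeGraph (galAdicCompletionMap (L := L) (IsCMField.complexConj L) hw) ϖ ((StdForm.antidiagonal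 3).over (w.1.adicCompletion L))).dist ⟨stdLattice (w.1.adicCompletion L) 3, 0, isSelfDualLattice_stdLattice_three_of_v hϖ⟩ p + 1 ∧ latticeGraphIso (galAdicCompletionMap (L := L) (IsCMField.complexConj L) hw) ϖ ((StdForm.antidiagonal 3).over (w.1.adicCompletion L)) γ' x = x)} ∧ (¬ x.1.map ((Matrix.toLin' (((γ' : GL (Fin 3) (w.1.adicCompletion L)) : Matrix (Fin 3) (Fin 3) (w.1.adicCompletion L)) - 1)).restrictScalars (Valued.integer (w.1.adicCompletion L))) ≤ scaleLattice (ϖ ^ m) x.1 ∧ (x.1.map ((Matrix.toLin' (((γ' : GL (Fin 3) (w.1.adicCompletion L)) : Matrix (Fin 3) (Fin 3) (w.1.adicCompletion L)) - 1)).restrictScalars (Valued.integer (w.1.adicCompletion L))) ≤ scaleLattice (ϖ ^ (m - 1)) x.1 ∧ ¬ x.1.map ((Matrix.toLin' (((γ' : GL (Fin 3) (w.1.adicCompletion L)) : Matrix (Fin 3) (Fin 3) (w.1.adicCompletion L)) - 1)).restrictScalars (Valued.integer (w.1.adicCompletion L))) ≤ scaleLattice (ϖ ^ m) x.1))}).ncard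 =
        Nat.card (Valued.ResidueField (w.1.adicCompletion L)) * Nat.card {p : Option {p : (Valued.ResidueField (w.1.adicCompletion L)) × (Valued.ResidueField (w.1.adicCompletion L)) // p.2 + (RingHom.id (Valued.ResidueField (w.1.adicCompletion L))) p.2 + p.1 * (RingHom.id (Valued.ResidueField (w.1.adicCompletion L))) p.1 = 0} //
        ((p.elim (Pi.single 2 1) fun q => ![(1 : (Valued.ResidueField (w.1.adicCompletion L))), q.1.1, q.1.2]) ⬝ᵥ
          ((((StdForm.antidiagonal 3).over (Valued.ResidueField (w.1.adicCompletion L))) * Y₀.map (IsLocalRing.residue (Valued.integer (w.1.adicCompletion L)))) *ᵥ (p.elim (Pi.single 2 1) fun q => ![(1 : (Valued.ResidueField (w.1.adicCompletion L))), q.1.1, q.1.2]))) = 0} ∧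
      ({x | x ∈ {x | ∃ p, ((latticeGraph (galAdicCompletionMap (L := L) (IsCMField.complexConj L) hw) ϖ ((StdForm.antidiagonal 3).over (w.1.adicCompletion L))).Adj (⟨stdLattice (w.1.adicCompletion L) 3, 0, isSelfDualLattice_stdLattice_three_of_v hϖ⟩ : {M : Submodule (Valued.integer (w.1.adicCompletion L)) (Fin 3 → (w.1.adicCompletion L)) // IsVertex (galAdicCompletionMap (L := L) (IsCMField.complexConj L) hw) ϖ ((StdForm.antidiagonal 3).over (w.1.adicCompletion L)) M}) p ∧ (latticeGraph (galAdicCompletionMap (L := L) (IsCMField.complexConj L) hw) ϖ ((StdForm.antidiagonal 3).over (w.1.adicCompletion L))).dist ⟨stdLattice (w.1.adicCompletion L) 3, 0, isSelfDualLattice_stdLattice_three_of_v hϖ⟩ p = (latticeGraph (galAdicCompletionMap (L := L) (IsCMField.complexConj L) hw) ϖ ((StdForm.antidiagonal 3).over (w.1.adicCompletion L))).dist ⟨stdLattice (w.1.adicCompletion L) 3, 0, isSelfDualLattice_stdLattice_three_of_v hϖ⟩ (⟨stdLattice (w.1.adicCompletion L) 3, 0, isSelfDualLattice_stdLattice_three_of_v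 hϖ⟩ : {M : Submodule (Valued.integer (w.1.adicCompletion L)) (Fin 3 → (w.1.adicCompletion L)) // IsVertex (galAdicCompletionMap (L := L) (IsCMField.complexConj L) hw) ϖ ((StdForm.antidiagonal 3).over (w.1.adicCompletion L)) M}) + 1 ∧ latticeGraphIso (galAdicCompletionMap (L := L) (IsCMField.complexConj L) hw) ϖ ((StdForm.antidiagonal 3).over (w.1.adicCompletion L)) γ' p = p) ∧ ((latticeGraph (galAdicCompletionMap (L := L) (IsCMField.complexConj L) hw) ϖ ((StdForm.antidiagonal 3).over (w.1.adicCompletion L))).Adj p x ∧ (latticeGraph (galAdicCompletionMap (L := L) (IsCMField.complexConj L) hw) ϖ ((StdForm.antidiagonal 3).over (w.1.adicCompletion L))).dist ⟨stdLattice (w.1.adicCompletion L) 3, 0, isSelfDualLattice_stdLattice_three_of_v hϖ⟩ x = (latticeGraph (galAdicCompletionMap (L := L) (IsCMField.complexConj L) hw) ϖ ((StdForm.antidiagonal 3).over (w.1.adicCompletion L))).dist ⟨stdLattice (w.1.adicCompletion L) 3, 0, isSelfDualLattice_stdLattice_three_of_v hϖ⟩ p + 1 ∧ latticeGraphIso (galAdicCompletionMap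 (L := L) (IsCMField.complexConj L) hw) ϖ ((StdForm.antidiagonal 3).over (w.1.adicCompletion L)) γ' x = x)} ∧ (¬ x.1.map ((Matrix.toLin' (((γ' : GL (Fin 3) (w.1.adicCompletion L)) : Matrix (Fin 3) (Fin 3) (w.1.adicCompletion L)) - 1)).restrictScalars (Valued.integer (w.1.adicCompletion L))) ≤ scaleLattice (ϖ ^ m) x.1 ∧ (x.1.map ((Matrix.toLin' (((γ' : GL (Fin 3) (w.1.adicCompletion L)) : Matrix (Fin 3) (Fin 3) (w.1.adicCompletion L)) - 1)).restrictScalars (Valued.integer (w.1.adicCompletion L))) ≤ scaleLattice (ϖ ^ (m - 2)) x.1 ∧ ¬ x.1.map ((Matrix.toLin' (((γ' : GL (Fin 3) (w.1.adicCompletion L)) : Matrix (Fin 3) (Fin 3) (w.1.adicCompletion L)) - 1)).restrictScalars (Valued.integer (w.1.adicCompletion L))) ≤ scaleLattice (ϖ ^ (m - 1)) x.1) ∧ ∃ y ∈ x.1, ∃ a : (w.1.adicCompletion L), Valued.v a = 1 ∧ Valued.v ((ϖ ^ (m - 2))⁻¹ * pairing (galAdicCompletionMap (L := L) (IsCMField.complexConj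 L) hw) ((StdForm.antidiagonal 3).over (w.1.adicCompletion L)) y ((((γ' : GL (Fin 3) (w.1.adicCompletion L)) : Matrix (Fin 3) (Fin 3) (w.1.adicCompletion L)) - 1) *ᵥ y) - (c) * a ^ 2) < 1)}).ncard =
        Nat.card (Valued.ResidueField (w.1.adicCompletion L)) * Nat.card {p : Option {p : (Valued.ResidueField (w.1.adicCompletion L)) × (Valued.ResidueField (w.1.adicCompletion L)) // p.2 + (RingHom.id (Valued.ResidueField (w.1.adicCompletion L))) p.2 + p.1 * (RingHom.id (Valued.ResidueField (w.1.adicCompletion L))) p.1 = 0} //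
        quadraticChar (Valued.ResidueField (w.1.adicCompletion L)) ((IsLocalRing.residue (Valued.integer (w.1.adicCompletion L)) (-c₀))⁻¹ * ((p.elim (Pi.single 2 1) fun q => ![(1 : (Valued.ResidueField (w.1.adicCompletion L))), q.1.1, q.1.2]) ⬝ᵥ
          ((((StdForm.antidiagonal 3).over (Valued.ResidueField (w.1.adicCompletion L))) * Y₀.map (IsLocalRing.residue (Valued.integer (w.1.adicCompletion L)))) *ᵥ (p.elim (Pi.single 2 1) fun q => ![(1 : (Valued.ResidueField (w.1.adicCompletion L))), q.1.1, q.1.2])))) = 1} ∧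
      ({x | x ∈ {x | ∃ p, ((latticeGraph (galAdicCompletionMap (L := L) (IsCMField.complexConj L) hw) ϖ ((StdForm.antidiagonal 3).over (w.1.adicCompletion L))).Adj (⟨stdLattice (w.1.adicCompletion L) 3, 0, isSelfDualLattice_stdLattice_three_of_v hϖ⟩ : {M : Submodule (Valued.integer (w.1.adicCompletion L)) (Fin 3 → (w.1.adicCompletion L)) // IsVertex (galAdicCompletionMap (L := L) (IsCMField.complexConj L) hw) ϖ ((StdForm.antidiagonal 3).over (w.1.adicCompletion L)) M}) p ∧ (latticeGraph (galAdicCompletionMap (L := L) (IsCMField.complexConj L) hw) ϖ ((StdForm.antidiagonal 3).over (w.1.adicCompletion L))).dist ⟨stdLattice (w.1.adicCompletion L) 3, 0, isSelfDualLattice_stdLattice_three_of_v hϖ⟩ p = (latticeGraph (galAdicCompletionMap (L := L) (IsCMField.complexConj L) hw) ϖ ((StdForm.antidiagonal 3).over (w.1.adicCompletion L))).dist ⟨stdLattice (w.1.adicCompletion L) 3, 0, isSelfDualLattice_stdLattice_three_of_v hϖ⟩ (⟨stdLattice (w.1.adicCompletion L) 3, 0, isSelfDualLattice_stdLattice_three_of_v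 hϖ⟩ : {M : Submodule (Valued.integer (w.1.adicCompletion L)) (Fin 3 → (w.1.adicCompletion L)) // IsVertex (galAdicCompletionMap (L := L) (IsCMField.complexConj L) hw) ϖ ((StdForm.antidiagonal 3).over (w.1.adicCompletion L)) M}) + 1 ∧ latticeGraphIso (galAdicCompletionMap (L := L) (IsCMField.complexConj L) hw) ϖ ((StdForm.antidiagonal 3).over (w.1.adicCompletion L)) γ' p = p) ∧ ((latticeGraph (galAdicCompletionMap (L := L) (IsCMField.complexConj L) hw) ϖ ((StdForm.antidiagonal 3).over (w.1.adicCompletion L))).Adj p x ∧ (latticeGraph (galAdicCompletionMap (L := L) (IsCMField.complexConj L) hw) ϖ ((StdForm.antidiagonal 3).over (w.1.adicCompletion L))).dist ⟨stdLattice (w.1.adicCompletion L) 3, 0, isSelfDualLattice_stdLattice_three_of_v hϖ⟩ x = (latticeGraph (galAdicCompletionMap (L := L) (IsCMField.complexConj L) hw) ϖ ((StdForm.antidiagonal 3).over (w.1.adicCompletion L))).dist ⟨stdLattice (w.1.adicCompletion L) 3, 0, isSelfDualLattice_stdLattice_three_of_v hϖ⟩ p + 1 ∧ latticeGraphIso (galAdicCompletionMap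 (L := L) (IsCMField.complexConj L) hw) ϖ ((StdForm.antidiagonal 3).over (w.1.adicCompletion L)) γ' x = x)} ∧ (¬ x.1.map ((Matrix.toLin' (((γ' : GL (Fin 3) (w.1.adicCompletion L)) : Matrix (Fin 3) (Fin 3) (w.1.adicCompletion L)) - 1)).restrictScalars (Valued.integer (w.1.adicCompletion L))) ≤ scaleLattice (ϖ ^ m) x.1 ∧ (x.1.map ((Matrix.toLin' (((γ' : GL (Fin 3) (w.1.adicCompletion L)) : Matrix (Fin 3) (Fin 3) (w.1.adicCompletion L)) - 1)).restrictScalars (Valued.integer (w.1.adicCompletion L))) ≤ scaleLattice (ϖ ^ (m - 2)) x.1 ∧ ¬ x.1.map ((Matrix.toLin' (((γ' : GL (Fin 3) (w.1.adicCompletion L)) : Matrix (Fin 3) (Fin 3) (w.1.adicCompletion L)) - 1)).restrictScalars (Valued.integer (w.1.adicCompletion L))) ≤ scaleLattice (ϖ ^ (m - 1)) x.1) ∧ ¬ (∃ y ∈ x.1, ∃ a : (w.1.adicCompletion L), Valued.v a = 1 ∧ Valued.v ((ϖ ^ (m - 2))⁻¹ * pairing (galAdicCompletionMap (L := L) (IsCMField.complexConj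 L) hw) ((StdForm.antidiagonal 3).over (w.1.adicCompletion L)) y ((((γ' : GL (Fin 3) (w.1.adicCompletion L)) : Matrix (Fin 3) (Fin 3) (w.1.adicCompletion L)) - 1) *ᵥ y) - (c) * a ^ 2) < 1))}).ncard =
        Nat.card (Valued.ResidueField (w.1.adicCompletion L)) * Nat.card {p : Option {p : (Valued.ResidueField (w.1.adicCompletion L)) × (Valued.ResidueField (w.1.adicCompletion L)) // p.2 + (RingHom.id (Valued.ResidueField (w.1.adicCompletion L))) p.2 + p.1 * (RingHom.id (Valued.ResidueField (w.1.adicCompletion L))) p.1 = 0} //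
        quadraticChar (Valued.ResidueField (w.1.adicCompletion L)) ((IsLocalRing.residue (Valued.integer (w.1.adicCompletion L)) (-c₀))⁻¹ * ((p.elim (Pi.single 2 1) fun q => ![(1 : (Valued.ResidueField (w.1.adicCompletion L))), q.1.1, q.1.2]) ⬝ᵥ
          ((((StdForm.antidiagonal 3).over (Valued.ResidueField (w.1.adicCompletion L))) * Y₀.map (IsLocalRing.residue (Valued.integer (w.1.adicCompletion L)))) *ᵥ (p.elim (Pi.single 2 1) fun q => ![(1 : (Valued.ResidueField (w.1.adicCompletion L))), q.1.1, q.1.2])))) = -1} := by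
  classical
  have hc1 : IsCMField.complexConj L ≠ 1 := IsCMField.complexConj_ne_one L
  have h2v : Valued.v (2 : (w.1.adicCompletion L)) = 1 := (isUnit_two_integer_iff_valued_eq_one L w.1).1 h2
  have hσσ : ∀ z : (w.1.adicCompletion L), (galAdicCompletionMap (L := L) (IsCMField.complexConj L) hw) ((galAdicCompletionMap (L := L) (IsCMField.complexConj L) hw) z) = z :=
    galAdicCompletionMap_galAdicCompletionMap_of_smul_eq (IsCMField.complexConj L) w hc1 hw
  have hvσ : ∀ z : (w.1.adicCompletion L), Valued.v ((galAdicCompletionMap (L := L) (IsCMField.complexConj L) hw) z) = Valued.v z := fun z =>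
    valued_galAdicCompletionMap (L := L) (IsCMField.complexConj L) hw z
  obtain ⟨-, -, -, hres, hnorm⟩ := ramifiedBlock_adicCompletion L v w hw he h2v
  haveI := isPrincipalIdealRing_integer_adicCompletion L v w
  have hq : (Fintype.card (Valued.ResidueField (w.1.adicCompletion L)) : ℂ) = (Ideal.absNorm v.asIdeal : ℂ) := by
    congr 1
    rw [Fintype.card_eq_nat_card, ← natCard_residueField_eq_of_compatible, natCard_residueField_eq_of_ramified (IsCMField.complexConj L) v hc1 w hw he,
      Ideal.absNorm_apply, Submodule.cardQuot_apply]
  have hsq : ∀ t : (w.1.adicCompletion L), Valued.v (t - 1) < 1 → IsSquare t := fun t ht => by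
    obtain ⟨r, hr, -⟩ := exists_sq_eq_of_valued_sub_one_lt w.1 h2v t ht
    exact ⟨r, by rw [← hr, sq]⟩
  have hε := valued_sq_sub_eq_one_of_not_exists_norm hσσ hvσ hres hnorm hση hηv hηN
  have hT := isTree_latticeGraph_three_of_neg hσσ hvσ hϖ hσϖ hres h2v hnorm
  have hϖ0 : ϖ ≠ 0 := fun h0 => by rw [h0, Valuation.map_zero] at hϖ; exact WithZero.exp_ne_zero hϖ.symm
  have hϖ2 : Valued.v (ϖ ^ 2) = Valued.v ϖ ^ 2 := map_pow _ _ _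
  have hϖlt : Valued.v ϖ < 1 := by rw [hϖ, ← WithZero.exp_zero]; exact WithZero.exp_lt_exp.2 (by norm_num)
  -- the middle eigenvalue `u_w`: norm one, `2`-deep; the centring unit `s`
  have hu00 : (((localNonsplitEquiv (IsCMField.complexConj L) (Matrix.of fun i j : Fin 1 => if i.val + j.val + 1 = 1 then (1 : L) else 0) (IsCMField.complexConj_ne_one L) w hw γH.2).val : GL (Fin 1) (w.1.adicCompletion L)) : Matrix (Fin 1) (Fin 1) (w.1.adicCompletion L)) 0 0 = finGammaTwo L v γH w := rfl
  have huu : (galAdicCompletionMap (L := L) (IsCMField.complexConj L) hw) (finGammaTwo L v γH w) * finGammaTwo L v γH w = 1 := by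
    have h := congrArg (fun y : LocalRing L v => y w) (conjLocal_finGammaTwo_mul_finGammaTwo L v γH)
    simpa only [Pi.mul_apply, Pi.one_apply, conjLocal_apply_eq_galAdicCompletionMap L v w hw] using h
  have huv : Valued.v (finGammaTwo L v γH w) = 1 := v_eq_one_of_mul_map_eq_one hvσ (by rw [mul_comm]; exact huu)
  have hu2' : Valued.v (finGammaTwo L v γH w - 1) ≤ Valued.v ϖ ^ 2 := by rw [← hϖ2]; exact hu2
  have hsnorm : (galAdicCompletionMap (L := L) (IsCMField.complexConj L) hw) (s : (w.1.adicCompletion L)) * (s : (w.1.adicCompletion L)) = 1 :=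
    norm_eq_one_of_mul_eq_one_of_norm_eq_one huu hs
  obtain ⟨hsv, hs1⟩ := v_eq_one_and_v_sub_one_le_of_mul_eq_one huv hu2' hs
  have hs' : (s : (w.1.adicCompletion L)) * (((localNonsplitEquiv (IsCMField.complexConj L) (Matrix.of fun i j : Fin 1 => if i.val + j.val + 1 = 1 then (1 : L) else 0) (IsCMField.complexConj_ne_one L) w hw γH.2).val : GL (Fin 1) (w.1.adicCompletion L)) : Matrix (Fin 1) (Fin 1) (w.1.adicCompletion L)) 0 0 = 1 := by
    rw [hu00]; exact hs
  -- the frame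
  have hform' : formCongr (galAdicCompletionMap (L := L) (IsCMField.complexConj L) hw) P₁ ((StdForm.antidiagonal 3).over (w.1.adicCompletion L)) =
      !![(Matrix.diagonal d) 0 0, 0, (Matrix.diagonal d) 0 1; 0, η, 0; (Matrix.diagonal d) 1 0, 0, (Matrix.diagonal d) 1 1] := by
    rw [← placeForm_antidiagOne]; exact hform
  obtain ⟨hPint, hPinv⟩ := isIntMatrix_and_isIntMatrix_inv_of_mem_glInt hP₁
  have hP0 : mapGL P₁ (stdLattice (w.1.adicCompletion L) 3) = stdLattice (w.1.adicCompletion L) 3 := (mapGL_stdLattice_eq_iff P₁).2 ⟨hPint, hPinv⟩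
  -- the block: unitary, rootless, integral; the depth `m` from the socket (conformality turns `|det| = |ϖ|^(2m)` into entrywise bounds)
  have hU : (((γ₁ : Matrix (Fin 2) (Fin 2) (w.1.adicCompletion L))).map (galAdicCompletionMap (L := L) (IsCMField.complexConj L) hw))ᵀ * Matrix.diagonal d *
      (γ₁ : Matrix (Fin 2) (Fin 2) (w.1.adicCompletion L)) = Matrix.diagonal d := hγU
  have hirr' : ∀ x : (w.1.adicCompletion L), ¬ ((γ₁ : Matrix (Fin 2) (Fin 2) (w.1.adicCompletion L)).charpoly).IsRoot x := fun x hx => hirrγ ⟨x, hx⟩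
  have hdet := valued_det_sub_smul_one_eq_of_tokens L w hw he ϖ hϖ γH m hm γ₁ hχ
  have hmm : Valued.v ϖ ^ (2 * m) = Valued.v ϖ ^ m * Valued.v ϖ ^ m := by rw [two_mul, pow_add]
  have hγd : ∀ i j, Valued.v (((γ₁ : Matrix (Fin 2) (Fin 2) (w.1.adicCompletion L)) - finGammaTwo L v γH w • (1 : Matrix (Fin 2) (Fin 2) (w.1.adicCompletion L))) i j) ≤ Valued.v ϖ ^ m :=
    forall_valued_sub_smul_one_apply_le_of_valued_det_le hvσ h2v hsq hd han₀ han₁ hU hirr' _ (by rw [← hu00, hdet, hmm])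
  have hA' : ∃ i j, Valued.v ϖ ^ m ≤ Valued.v (((γ₁ : Matrix (Fin 2) (Fin 2) (w.1.adicCompletion L)) - finGammaTwo L v γH w • (1 : Matrix (Fin 2) (Fin 2) (w.1.adicCompletion L))) i j) :=
    exists_le_valued_sub_smul_one_apply_of_le_valued_det hvσ h2v hsq hd han₀ han₁ hU hirr' _ (by rw [← hu00, hdet, hmm])
  have hγ₁int : ∀ i j, Valued.v ((γ₁ : Matrix (Fin 2) (Fin 2) (w.1.adicCompletion L)) i j) ≤ 1 :=
    isIntMatrix_of_forall_v_sub_one_le_of_lt_one (C := Valued.v (ϖ ^ 2)) (by rw [hϖ2]; exact pow_lt_one₀ zero_le hϖlt two_ne_zero) hγ2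
  -- the centred block `s·γ₁`
  have hcoe : ((Matrix.GeneralLinearGroup.scalar (Fin 2) s * γ₁ : GL (Fin 2) (w.1.adicCompletion L)) : Matrix (Fin 2) (Fin 2) (w.1.adicCompletion L)) =
      (s : (w.1.adicCompletion L)) • (γ₁ : Matrix (Fin 2) (Fin 2) (w.1.adicCompletion L)) := coe_scalar_mul_two_eq_smul s γ₁
  have hBm : ∀ i j, Valued.v ((((Matrix.GeneralLinearGroup.scalar (Fin 2) s * γ₁ : GL (Fin 2) (w.1.adicCompletion L)) : Matrix (Fin 2) (Fin 2) (w.1.adicCompletion L)) - 1) i j) ≤ Valued.v ϖ ^ m := fun i j => by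
    rw [hcoe, v_smul_sub_one_apply_eq_of_mul_eq_one _ hs hsv]; exact hγd i j
  have hA'' : ∃ i j, Valued.v ϖ ^ m ≤ Valued.v ((((Matrix.GeneralLinearGroup.scalar (Fin 2) s * γ₁ : GL (Fin 2) (w.1.adicCompletion L)) : Matrix (Fin 2) (Fin 2) (w.1.adicCompletion L)) -
      ((1 : GL (Fin 1) (w.1.adicCompletion L)) : Matrix (Fin 1) (Fin 1) (w.1.adicCompletion L)) 0 0 • (1 : Matrix (Fin 2) (Fin 2) (w.1.adicCompletion L))) i j) := by
    obtain ⟨i, j, hij⟩ := hA'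
    refine ⟨i, j, ?_⟩
    rw [Units.val_one, Matrix.one_apply_eq, one_smul, hcoe, v_smul_sub_one_apply_eq_of_mul_eq_one _ hs hsv]; exact hij
  have hγint : ∀ i j, Valued.v (((Matrix.GeneralLinearGroup.scalar (Fin 2) s * γ₁ : GL (Fin 2) (w.1.adicCompletion L)) : Matrix (Fin 2) (Fin 2) (w.1.adicCompletion L)) i j) ≤ 1 := by
    rw [hcoe]; exact forall_v_smul_apply_le_one hsv.le hγ₁int
  have hγU' := scalar_mul_mem_unitaryGroupOfForm hγU s hsnorm
  have hirr'' : ∀ x : (w.1.adicCompletion L), ¬ (((Matrix.GeneralLinearGroup.scalar (Fin 2) s * γ₁ : GL (Fin 2) (w.1.adicCompletion L)) : Matrix (Fin 2) (Fin 2) (w.1.adicCompletion L)).charpoly).IsRoot x := by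
    rw [hcoe]; exact forall_not_isRoot_charpoly_smul (Units.ne_zero s) hirr'
  have hu1 : Valued.v (((1 : GL (Fin 1) (w.1.adicCompletion L)) : Matrix (Fin 1) (Fin 1) (w.1.adicCompletion L)) 0 0) ≤ 1 := by
    rw [Units.val_one, Matrix.one_apply_eq, map_one]
  have hlam : Valued.v ((1 : (w.1.adicCompletion L)) - 1) ≤ Valued.v ϖ ^ m := by rw [sub_self, map_zero]; exact zero_le
  -- the centred literal `γ′`: characteristic polynomial, root token, integrality
  have hchar : (((γ' : GL (Fin 3) (w.1.adicCompletion L)) : Matrix (Fin 3) (Fin 3) (w.1.adicCompletion L))).charpoly =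
      (X - C (1 : (w.1.adicCompletion L))) * (((Matrix.GeneralLinearGroup.scalar (Fin 2) s * γ₁ : GL (Fin 2) (w.1.adicCompletion L)) : Matrix (Fin 2) (Fin 2) (w.1.adicCompletion L))).charpoly := by
    rw [hγ']; exact charpoly_coe_conj_endoGL_one P₁ _
  have hroot : (stdLattice (w.1.adicCompletion L) 3).map ((Matrix.toLin' (((γ' : GL (Fin 3) (w.1.adicCompletion L)) : Matrix (Fin 3) (Fin 3) (w.1.adicCompletion L)) - 1)).restrictScalars (Valued.integer (w.1.adicCompletion L))) ≤
      scaleLattice (ϖ ^ m) (stdLattice (w.1.adicCompletion L) 3) := by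
    rw [hγ']
    exact map_sub_one_stdLattice_le_scaleLattice_of_conj_endoGL_one (pow_ne_zero _ hϖ0) hPint hPinv (fun i j => by rw [map_pow]; exact hBm i j)
  have hm1 : 1 ≤ m := by omega
  have hlt1 : Valued.v ϖ ^ m < 1 := pow_lt_one₀ zero_le hϖlt (by omega)
  have hγ'0 : γ' ∈ unitaryInt (galAdicCompletionMap (L := L) (IsCMField.complexConj L) hw) ((StdForm.antidiagonal 3).over (w.1.adicCompletion L)) := by
    have h1 : IsIntMatrix (((γ' : GL (Fin 3) (w.1.adicCompletion L)) : Matrix (Fin 3) (Fin 3) (w.1.adicCompletion L))) := by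
      rw [hγ']; exact isIntMatrix_coe_conj_endoGL hPint hPinv hγint isIntMatrix_coe_one
    have h2' : IsIntMatrix ((((γ' : GL (Fin 3) (w.1.adicCompletion L)))⁻¹ : GL (Fin 3) (w.1.adicCompletion L)) : Matrix (Fin 3) (Fin 3) (w.1.adicCompletion L)) := by
      rw [hγ']
      exact isIntMatrix_coe_conj_endoGL_inv hPint hPinv (isIntMatrix_coe_inv_of_forall_v_sub_one_le_of_lt_one hlt1 hBm)
        (by rw [inv_one]; exact isIntMatrix_coe_one)
    have h := mem_unitaryInt_of_isIntMatrix γ'.2 h1 h2'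
    simpa only [Subtype.coe_eta] using h
  have hmodd : Odd m := ⟨n, by omega⟩
  have hm3 : 3 ≤ m := by omega
  -- NON-CONTRACTION of `s·γ₁ − 1` at depth `m` (★ F0P3a-p08) and the residual frame at the tie (★ p849644)
  have hTnc := nonContraction_of_unitary_anisotropic_of_entry hvσ h2v hsq hd han₀ han₁ (Matrix.GeneralLinearGroup.scalar (Fin 2) s * γ₁) hγU' hirr''
    (1 : GL (Fin 1) (w.1.adicCompletion L)) hA''
  have hirrS : ¬ ∃ x : (w.1.adicCompletion L), (((Matrix.GeneralLinearGroup.scalar (Fin 2) s * γ₁ : GL (Fin 2) (w.1.adicCompletion L)) : Matrix (Fin 2) (Fin 2) (w.1.adicCompletion L)).charpoly).IsRoot x := fun ⟨x, hx⟩ => hirr'' x hx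
  have hdisc' : Valued.v (((Matrix.GeneralLinearGroup.scalar (Fin 2) s * γ₁ : GL (Fin 2) (w.1.adicCompletion L)) : Matrix (Fin 2) (Fin 2) (w.1.adicCompletion L)).trace ^ 2 - 4 * ((Matrix.GeneralLinearGroup.scalar (Fin 2) s * γ₁ : GL (Fin 2) (w.1.adicCompletion L)) : Matrix (Fin 2) (Fin 2) (w.1.adicCompletion L)).det) = Valued.v ϖ ^ (2 * m) := by
    rw [hcoe, v_trace_sq_sub_four_mul_det_smul hsv, hdiscγ, hϖ, ← WithZero.exp_nsmul, hmN]
    congr 1; push_cast; ring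
  have hu1lt : Valued.v (((1 : GL (Fin 1) (w.1.adicCompletion L)) : Matrix (Fin 1) (Fin 1) (w.1.adicCompletion L)) 0 0 - 1) < Valued.v ϖ ^ m := by
    rw [Units.val_one, Matrix.one_apply_eq, sub_self, map_zero]; exact zero_lt_iff.2 (pow_ne_zero _ ((Valuation.ne_zero_iff _).2 hϖ0))
  obtain ⟨Ab, Y₀, T, B, hY₀, hTe, hG, hδ0, hχan, hY, hB10, hB12, hB01, hB21, hB11, hB00, hB02, hB20, hB22, hadj, hirrB⟩ :=
    exists_residualFrame_of_coe_eq_conj_endoGL_of_tie hvσ hres hσϖ hϖ h2v hsq hd hηv han₀ P₁ hform' hP0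
      (Matrix.GeneralLinearGroup.scalar (Fin 2) s * γ₁) (1 : GL (Fin 1) (w.1.adicCompletion L)) hγ' hγU' hirrS hmodd hBm hdisc' hu1lt
      ⟨d 0, (hd 0).le⟩ ⟨d 1, (hd 1).le⟩ ⟨η, hηv.le⟩ rfl rfl rfl
  -- THE THREE ROOT SLICES (★ p849483 §2) with `ν := Nat.card` through THE JUNCTION (★ p849383)
  have hc₀' : (c₀ : (w.1.adicCompletion L)) = c := hc₀
  have hE := ncard_rootChildren_null_eq_natCard hσσ hvσ hσϖ hϖ hres h2v γ' Y₀ hY₀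
  have hP := ncard_rootChildren_negClass_eq_natCard hσσ hvσ hσϖ hϖ hres h2v γ' Y₀ hY₀ c c₀ hc₀' hc
  have hM := ncard_rootChildren_negClass_mul_eq_natCard hσσ hvσ hσϖ hϖ hres h2v γ' Y₀ hY₀ c η c₀ ⟨η, hηv.le⟩ hc₀' rfl hc hηv hε
  obtain ⟨hSE, hSP, hSM⟩ := rootSlices_anisotropic_of_lineCounts hσσ hvσ hσϖ hϖ hres h2v hT hγ'0 P₁ hform' hP0 han₀ han₁ hηv
    (Matrix.GeneralLinearGroup.scalar (Fin 2) s * γ₁) (1 : GL (Fin 1) (w.1.adicCompletion L)) hγ' hm3 hmodd hTnc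
    (fun x e he hlev => map_sub_one_pow_three_le_scaleLattice_of_charpoly_block_antidiagonal hϖ hchar (d := e) (by rw [sub_self, map_zero]; exact zero_le)
      (fun i j => (hBm i j).trans (pow_le_pow_right_of_le_one' hϖlt.le he)) x hlev)
    hroot c η hc hηv hε _ _ _ hE hP hM
  -- THE KEYS `χ(η̄) = −1`, `χ(δ₁δ₀δ₂) = χ(−1)`
  have hχη : quadraticChar (Valued.ResidueField (w.1.adicCompletion L)) (IsLocalRing.residue (Valued.integer (w.1.adicCompletion L)) ⟨η, hηv.le⟩) = -1 :=
    quadraticChar_residue_eq_neg_one_of_forall hε ⟨η, hηv.le⟩ rfl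
  have hkey : quadraticChar (Valued.ResidueField (w.1.adicCompletion L)) (IsLocalRing.residue (Valued.integer (w.1.adicCompletion L)) ⟨η, hηv.le⟩ * IsLocalRing.residue (Valued.integer (w.1.adicCompletion L)) ⟨d 0, (hd 0).le⟩ * IsLocalRing.residue (Valued.integer (w.1.adicCompletion L)) ⟨d 1, (hd 1).le⟩) =
      quadraticChar (Valued.ResidueField (w.1.adicCompletion L)) (-1) := by
    have h1 : quadraticChar (Valued.ResidueField (w.1.adicCompletion L)) (-1) * quadraticChar (Valued.ResidueField (w.1.adicCompletion L)) (IsLocalRing.residue (Valued.integer (w.1.adicCompletion L)) ⟨d 0, (hd 0).le⟩ * IsLocalRing.residue (Valued.integer (w.1.adicCompletion L)) ⟨d 1, (hd 1).le⟩) = -1 := by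
      rw [← map_mul, neg_one_mul]; exact hχan
    have hsq1 : quadraticChar (Valued.ResidueField (w.1.adicCompletion L)) (-1) * quadraticChar (Valued.ResidueField (w.1.adicCompletion L)) (-1) = 1 := by
      rw [← map_mul, neg_one_mul, neg_neg, map_one]
    rw [mul_assoc, map_mul, hχη]
    linear_combination quadraticChar (Valued.ResidueField (w.1.adicCompletion L)) (IsLocalRing.residue (Valued.integer (w.1.adicCompletion L)) ⟨d 0, (hd 0).le⟩ * IsLocalRing.residue (Valued.integer (w.1.adicCompletion L)) ⟨d 1, (hd 1).le⟩) * hsq1 - quadraticChar (Valued.ResidueField (w.1.adicCompletion L)) (-1) * h1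
  -- THE SIGN: `χ(det T̄) = (β, θ)_v` via `det(s·γ₁ − 1) = s²·(χ_g(u))_w`
  have hev : ((finCharpolyTwo L v γH).eval (finGammaTwo L v γH)) w =
      ((γ₁ : Matrix (Fin 2) (Fin 2) (w.1.adicCompletion L)).charpoly).eval (finGammaTwo L v γH w) := by
    rw [hχ, Matrix.charpoly_map]
    change Pi.evalRingHom (fun w' : PlacesOver L v => w'.1.adicCompletion L) w ((finCharpolyTwo L v γH).eval (finGammaTwo L v γH)) =
      ((finCharpolyTwo L v γH).map (Pi.evalRingHom (fun w' : PlacesOver L v => w'.1.adicCompletion L) w)).eval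
        (Pi.evalRingHom (fun w' : PlacesOver L v => w'.1.adicCompletion L) w (finGammaTwo L v γH))
    rw [Polynomial.eval_map, Polynomial.eval₂_at_apply]
  have hdet2 : (((Matrix.GeneralLinearGroup.scalar (Fin 2) s * γ₁ : GL (Fin 2) (w.1.adicCompletion L)) : Matrix (Fin 2) (Fin 2) (w.1.adicCompletion L)) - 1).det = (s : (w.1.adicCompletion L)) ^ 2 * ((finCharpolyTwo L v γH).eval (finGammaTwo L v γH)) w := by
    rw [hev, eval_charpoly_fin_two_eq_det_sub_smul_one, hcoe, Matrix.det_fin_two, Matrix.det_fin_two]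
    simp only [Matrix.sub_apply, Matrix.smul_apply, Matrix.one_apply_eq, ne_eq, zero_ne_one, not_false_eq_true, Matrix.one_apply_ne, one_ne_zero,
      smul_eq_mul, sub_zero]
    linear_combination ((s : (w.1.adicCompletion L)) * ((γ₁ : Matrix (Fin 2) (Fin 2) (w.1.adicCompletion L)) 0 0 + (γ₁ : Matrix (Fin 2) (Fin 2) (w.1.adicCompletion L)) 1 1) - 1 - (s : (w.1.adicCompletion L)) * finGammaTwo L v γH w) * hs
  have hdetT : (((T 0 0 * T 1 1 - T 0 1 * T 1 0 : Valued.integer (w.1.adicCompletion L)) : Valued.integer (w.1.adicCompletion L)) : (w.1.adicCompletion L)) =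
      (s : (w.1.adicCompletion L)) ^ 2 * (((finCharpolyTwo L v γH).eval (finGammaTwo L v γH)) w / ϖ ^ (2 * m)) := by
    have e : (((T 0 0 * T 1 1 - T 0 1 * T 1 0 : Valued.integer (w.1.adicCompletion L)) : Valued.integer (w.1.adicCompletion L)) : (w.1.adicCompletion L)) = ((ϖ ^ m)⁻¹) ^ 2 * (((Matrix.GeneralLinearGroup.scalar (Fin 2) s * γ₁ : GL (Fin 2) (w.1.adicCompletion L)) : Matrix (Fin 2) (Fin 2) (w.1.adicCompletion L)) - 1).det := by
      simp only [AddSubgroupClass.coe_sub, MulMemClass.coe_mul, hTe, Matrix.det_fin_two]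
      ring
    rw [e, hdet2, pow_mul, ← inv_pow]
    ring
  have hvχ : Valued.v (((finCharpolyTwo L v γH).eval (finGammaTwo L v γH)) w) = Valued.v ϖ ^ (2 * m) := by
    rw [hm, map_pow, valued_toPlace_eq_pow_two_of_ramified (IsCMField.complexConj L) w hc1 hw he, HeckeCharacter.valued_uniformizer, hϖ, ← pow_mul]
  have hvdet : Valued.v ((((T 0 0 * T 1 1 - T 0 1 * T 1 0 : Valued.integer (w.1.adicCompletion L)) : Valued.integer (w.1.adicCompletion L)) : (w.1.adicCompletion L))) = 1 := by
    rw [hdetT, map_mul, map_pow, hsv, one_pow, one_mul, map_div₀, hvχ, map_pow, div_self (pow_ne_zero _ ((Valuation.ne_zero_iff _).2 hϖ0))]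
  have hres0 : IsLocalRing.residue (Valued.integer (w.1.adicCompletion L)) (T 0 0 * T 1 1 - T 0 1 * T 1 0) ≠ 0 := fun h => by
    rw [residue_eq_zero_iff_v_lt_one, hvdet] at h; exact lt_irrefl _ h
  have hs0r : IsLocalRing.residue (Valued.integer (w.1.adicCompletion L)) ⟨(s : (w.1.adicCompletion L)), hsv.le⟩ ≠ 0 := fun h => by
    rw [residue_eq_zero_iff_v_lt_one] at h; exact (ne_of_lt h) hsv
  have hHS1 := typeTwo_hilbertSymbol_eq_one_iff_exists_sq_ram L w hw he h2 ϖ hϖ hσϖ hblk hu2 hmodd hm β hβ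
  have hbridge : (∃ z : w.1.adicCompletion L, Valued.v z = 1 ∧ Valued.v (((finCharpolyTwo L v γH).eval (finGammaTwo L v γH)) w / ϖ ^ (2 * m) - z ^ 2) < 1) ↔
      quadraticChar (Valued.ResidueField (w.1.adicCompletion L)) (IsLocalRing.residue (Valued.integer (w.1.adicCompletion L)) (T 0 0 * T 1 1 - T 0 1 * T 1 0)) = 1 := by
    have key := exists_unit_v_sub_mul_sq_lt_one_iff_residue (T 0 0 * T 1 1 - T 0 1 * T 1 0) (⟨(s : (w.1.adicCompletion L)), hsv.le⟩ ^ 2)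
    have hs2 : Valued.v ((s : (w.1.adicCompletion L)) ^ 2) = 1 := by rw [map_pow, hsv, one_pow]
    have step1 : (∃ z : w.1.adicCompletion L, Valued.v z = 1 ∧ Valued.v (((finCharpolyTwo L v γH).eval (finGammaTwo L v γH)) w / ϖ ^ (2 * m) - z ^ 2) < 1) ↔
        ∃ a₀ : w.1.adicCompletion L, Valued.v a₀ = 1 ∧ Valued.v ((((T 0 0 * T 1 1 - T 0 1 * T 1 0 : Valued.integer (w.1.adicCompletion L)) : Valued.integer (w.1.adicCompletion L)) : (w.1.adicCompletion L)) -
          (((⟨(s : (w.1.adicCompletion L)), hsv.le⟩ ^ 2 : Valued.integer (w.1.adicCompletion L)) : Valued.integer (w.1.adicCompletion L)) : (w.1.adicCompletion L)) * a₀ ^ 2) < 1 := by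
      refine exists_congr fun z => and_congr_right fun _ => ?_
      rw [hdetT, show (((⟨(s : (w.1.adicCompletion L)), hsv.le⟩ ^ 2 : Valued.integer (w.1.adicCompletion L)) : Valued.integer (w.1.adicCompletion L)) : (w.1.adicCompletion L)) =
        (s : (w.1.adicCompletion L)) ^ 2 by push_cast; rfl, ← mul_sub, Valuation.map_mul, hs2, one_mul]
    rw [step1, key]
    have step2 : (∃ a : Valued.ResidueField (w.1.adicCompletion L), a ≠ 0 ∧ IsLocalRing.residue (Valued.integer (w.1.adicCompletion L)) (T 0 0 * T 1 1 - T 0 1 * T 1 0) =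
        IsLocalRing.residue (Valued.integer (w.1.adicCompletion L)) (⟨(s : (w.1.adicCompletion L)), hsv.le⟩ ^ 2) * a ^ 2) ↔
        ∃ b : Valued.ResidueField (w.1.adicCompletion L), b ≠ 0 ∧ IsLocalRing.residue (Valued.integer (w.1.adicCompletion L)) (T 0 0 * T 1 1 - T 0 1 * T 1 0) = 1 * b ^ 2 := by
      constructor
      · rintro ⟨a, ha, h⟩
        exact ⟨IsLocalRing.residue (Valued.integer (w.1.adicCompletion L)) ⟨(s : (w.1.adicCompletion L)), hsv.le⟩ * a, mul_ne_zero hs0r ha, by rw [h, map_pow]; ring⟩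
      · rintro ⟨b, hb, h⟩
        refine ⟨(IsLocalRing.residue (Valued.integer (w.1.adicCompletion L)) ⟨(s : (w.1.adicCompletion L)), hsv.le⟩)⁻¹ * b, mul_ne_zero (inv_ne_zero hs0r) hb, ?_⟩
        rw [h, map_pow]; field_simp
    rw [step2, exists_ne_zero_eq_mul_sq_iff_quadraticChar one_ne_zero, inv_one, one_mul]
  exact ⟨Ab, ![IsLocalRing.residue (Valued.integer (w.1.adicCompletion L)) ⟨d 0, (hd 0).le⟩, IsLocalRing.residue (Valued.integer (w.1.adicCompletion L)) ⟨η, hηv.le⟩, IsLocalRing.residue (Valued.integer (w.1.adicCompletion L)) ⟨d 1, (hd 1).le⟩], Y₀, T, B, hY₀, hTe, hG, hδ0, hχan, hχη, hkey, hY,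
    hB10, hB12, hB01, hB21, hB11, hB00, hB02, hB20, hB22, hadj, hirrB, hres0, hHS1.trans hbridge, hSE, hSP, hSM⟩

end Literature.NumberTheory.Rogawski1990.BlockLawAniso

end
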